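import Mathlib
import Summits.Ventures.PercRepro2.Defs
import Summits.Ventures.PercRepro2.Independence
import Summits.Ventures.PercRepro2.Harris
import Summits.Ventures.PercRepro2.Graph
import Summits.Ventures.PercRepro2.Exploration

/-!
# The core-free union theorem (PART), part 1: the frame of a partition (blind cell PercRepro2,
typer-1; mine-1 g9 `proofs/MINE1-IID-UNION.md` §2 "THEOREM (the core-free case, (PU-V) at w ≡ 0 =
(PART))"; lead g11 13:37:16Z "then the η-branch factorisation for mine-1's core-free (PART) on
Griffiths.griffiths_one")

Root `l`; a partition of `V ∖ {l}` into the two sides of `τ : V → Bool` (`τ l = false`):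
`side l τ true = {τ = true} ∪ {l}` and `side l τ false = {τ = false}` (`sideSet`). The objects of
mine-1's factorisation:

* `crossEdge ends l τ e`: `e` joins the two sides away from `l` (both ends `≠ l`, `τ` differs);
* `rootEdge ends l e`: a non-loop edge at `l`; `(ends e).IsDiag`: a loop;
* `spanning ends l = {η ∣ every vertex is joined to l}`.

Facts: connection ignores loops (`conn_congr_nonloop`), so `internallyConnected ends l W` depends
only on the NON-LOOP edges inside `W` (`dependsOn_internallyConnected_nonloop`) — this is what makes
the two sides' internal-connection events independent (their inside-edge sets meet only in loops
at `l`); a cross edge is inside neither side (`crossEdge_not_within`); and the **side-closure lemma**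
`conn_restrict_side_of_spanning`: if `η` spans and every cross edge is closed, every vertex of a side
is joined to `l` INSIDE that side.
-/

namespace Summit.Ventures.PercRepro2

namespace Part

open scoped Classical

variable {V : Type*} {E : Type*}

/-! ## Loops and connection -/

section Loops

variable (ends : E → Sym2 V)

/-- Adjacency in the open subgraph only sees non-loop edges. -/
lemma openGraph_eq_of_eqOn_nonloop {ω ω' : Config E}
    (h : ∀ e, ¬ (ends e).IsDiag → ω e = ω' e) : openGraph ends ω = openGraph ends ω' := by
  ext u v
  rw [openGraph_adj, openGraph_adj]
  constructor
  · rintro ⟨huv, e, he, hends⟩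
    refine ⟨huv, e, ?_, hends⟩
    rw [← h e (by rw [hends, Sym2.mk_isDiag_iff]; exact huv)]; exact he
  · rintro ⟨huv, e, he, hends⟩
    refine ⟨huv, e, ?_, hends⟩
    rw [h e (by rw [hends, Sym2.mk_isDiag_iff]; exact huv)]; exact he

/-- Connection only sees non-loop edges. -/
lemma conn_congr_nonloop {ω ω' : Config E} (h : ∀ e, ¬ (ends e).IsDiag → ω e = ω' e) (u v : V) :
    Conn ends ω u v ↔ Conn ends ω' u v := by
  unfold Conn
  rw [openGraph_eq_of_eqOn_nonloop ends h]

/-- `internallyConnected` is determined by the non-loop edges inside `S`. -/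
lemma dependsOn_internallyConnected_nonloop (v : V) (S : Set V) :
    DependsOn (· ∈ internallyConnected ends v S) (within ends S ∩ {e | ¬ (ends e).IsDiag}) := by
  intro ω ω' h
  have h' : ∀ e, ¬ (ends e).IsDiag →
      restrict (within ends S) ω e = restrict (within ends S) ω' e := by
    intro e he
    by_cases hin : e ∈ within ends S
    · rw [restrict_apply_of_mem hin, restrict_apply_of_mem hin]; exact h e ⟨hin, he⟩
    · rw [restrict_apply_of_notMem hin, restrict_apply_of_notMem hin]
  show (v ∈ S ∧ ∀ u ∈ S, Conn ends (restrict (within ends S) ω) v u) =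
    (v ∈ S ∧ ∀ u ∈ S, Conn ends (restrict (within ends S) ω') v u)
  simp only [conn_congr_nonloop ends h']

end Loops

/-! ## The frame -/

section Frame

variable (ends : E → Sym2 V) (l : V)

/-- The side `b` of the partition, with the root adjoined: `{v ∣ τ v = b} ∪ {l}`. -/
def sideSet (τ : V → Bool) (b : Bool) : Set V := {v | τ v = b ∨ v = l}

/-- A cross edge: both ends `≠ l`, on different sides. -/
def crossEdge (τ : V → Bool) (e : E) : Prop :=
  ∃ u v, ends e = s(u, v) ∧ u ≠ l ∧ v ≠ l ∧ τ u ≠ τ v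

/-- A root edge: a non-loop edge at `l`. -/
def rootEdge (e : E) : Prop := ∃ v, v ≠ l ∧ ends e = s(l, v)

/-- `η` spans: every vertex is joined to `l`. -/
def spanning : Set (Config E) := {η | ∀ v, Conn ends η l v}

/-- Every cross edge is closed. -/
def crossClosed (τ : V → Bool) : Set (Config E) := {η | ∀ e, crossEdge ends l τ e → η e = false}

variable {ends l}

/-- `l` lies on both sides. -/
lemma root_mem_sideSet (τ : V → Bool) (b : Bool) : l ∈ sideSet l τ b := Or.inr rfl

/-- Membership in a side. -/
lemma mem_sideSet {τ : V → Bool} {b : Bool} {v : V} :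
    v ∈ sideSet l τ b ↔ τ v = b ∨ v = l := Iff.rfl

/-- A vertex `≠ l` is on the side of its colour only. -/
lemma mem_sideSet_iff_of_ne {τ : V → Bool} {b : Bool} {v : V} (hv : v ≠ l) :
    v ∈ sideSet l τ b ↔ τ v = b := by
  simp [mem_sideSet, hv]

/-- The side `false` with `τ l = false` is exactly `{τ = false}`. -/
lemma sideSet_false_eq {τ : V → Bool} (hl : τ l = false) :
    sideSet l τ false = {v | τ v = false} := by
  ext v
  simp only [mem_sideSet, Set.mem_setOf_eq]
  constructor
  · rintro (h | rfl)
    · exact h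
    · exact hl
  · exact Or.inl

/-- The side `true` with `τ l = false` is `{τ = true} ∪ {l}`. -/
lemma sideSet_true_eq (τ : V → Bool) : sideSet l τ true = {v | τ v = true} ∪ {l} := by
  ext v; simp [mem_sideSet, or_comm]

/-- Cross edges are symmetric in the roles of the two sides. -/
lemma crossEdge_comm {τ : V → Bool} {e : E} {u v : V} (hends : ends e = s(u, v)) :
    crossEdge ends l τ e ↔ u ≠ l ∧ v ≠ l ∧ τ u ≠ τ v := by
  constructor
  · rintro ⟨u', v', hends', hu', hv', hne⟩
    rw [hends, Sym2.eq_iff] at hends'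
    rcases hends' with ⟨rfl, rfl⟩ | ⟨rfl, rfl⟩
    · exact ⟨hu', hv', hne⟩
    · exact ⟨hv', hu', fun h => hne h.symm⟩
  · rintro ⟨hu, hv, hne⟩
    exact ⟨u, v, hends, hu, hv, hne⟩

/-- A cross edge is inside neither side. -/
lemma crossEdge_not_within {τ : V → Bool} {e : E} (h : crossEdge ends l τ e) (b : Bool) :
    e ∉ within ends (sideSet l τ b) := by
  obtain ⟨u, v, hends, hu, hv, hne⟩ := h
  rintro ⟨x, hx, y, hy, hxy⟩
  rw [hends, Sym2.eq_iff] at hxy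
  rcases hxy with ⟨rfl, rfl⟩ | ⟨rfl, rfl⟩
  · exact hne (((mem_sideSet_iff_of_ne hu).1 hx).trans ((mem_sideSet_iff_of_ne hv).1 hy).symm)
  · exact hne (((mem_sideSet_iff_of_ne hu).1 hy).trans ((mem_sideSet_iff_of_ne hv).1 hx).symm)

/-- A cross edge is not a loop. -/
lemma crossEdge_not_isDiag {τ : V → Bool} {e : E} (h : crossEdge ends l τ e) :
    ¬ (ends e).IsDiag := by
  obtain ⟨u, v, hends, _, _, hne⟩ := h
  rw [hends, Sym2.mk_isDiag_iff]
  rintro rfl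
  exact hne rfl

/-- The non-loop inside edges of the two sides are disjoint (they meet only in loops at `l`). -/
lemma disjoint_within_sides (τ : V → Bool) :
    Disjoint (within ends (sideSet l τ true) ∩ {e | ¬ (ends e).IsDiag})
      (within ends (sideSet l τ false) ∩ {e | ¬ (ends e).IsDiag}) := by
  rw [Set.disjoint_left]
  rintro e ⟨⟨x, hx, y, hy, hxy⟩, hnd⟩ ⟨⟨x', hx', y', hy', hxy'⟩, _⟩
  apply hnd
  rw [hxy, Sym2.mk_isDiag_iff]
  rw [hxy, Sym2.eq_iff] at hxy'
  -- both ends lie on both sides, hence both equal `l`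
  have key : ∀ z, z ∈ sideSet l τ true → z ∈ sideSet l τ false → z = l := by
    intro z h1 h2
    by_contra hz
    rw [mem_sideSet_iff_of_ne hz] at h1 h2
    rw [h1] at h2
    exact Bool.true_eq_false.mp h2
  rcases hxy' with ⟨rfl, rfl⟩ | ⟨rfl, rfl⟩
  · rw [key x hx hx', key y hy hy']
  · rw [key x hx hy', key y hy hx']

/-- Cross edges are disjoint from the inside edges of both sides. -/
lemma disjoint_within_sides_cross (τ : V → Bool) :
    Disjoint (within ends (sideSet l τ true) ∩ {e | ¬ (ends e).IsDiag} ∪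
        within ends (sideSet l τ false) ∩ {e | ¬ (ends e).IsDiag})
      {e | crossEdge ends l τ e} := by
  rw [Set.disjoint_left]
  rintro e (⟨h, _⟩ | ⟨h, _⟩) hc
  · exact crossEdge_not_within hc true h
  · exact crossEdge_not_within hc false h

/-- `crossClosed` is determined by the cross edges. -/
lemma dependsOn_crossClosed (τ : V → Bool) :
    DependsOn (· ∈ crossClosed ends l τ) {e | crossEdge ends l τ e} := by
  intro ω ω' h
  show (∀ e, crossEdge ends l τ e → ω e = false) = (∀ e, crossEdge ends l τ e → ω' e = false)
  exact propext (forall_congr' fun e => forall_congr' fun he => by rw [h e he])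

end Frame

/-! ## The side-closure lemma -/

section Closure

variable {ends : E → Sym2 V} {l : V}

/-- **Side closure**: if `η` spans and every cross edge is closed, then every vertex of a side is
joined to `l` inside that side (`τ l = false`). -/
lemma conn_restrict_side_of_spanning {τ : V → Bool} (hl : τ l = false) {η : Config E}
    (hsp : η ∈ spanning ends l) (hcl : η ∈ crossClosed ends l τ) (b : Bool) :
    ∀ u ∈ sideSet l τ b, Conn ends (restrict (within ends (sideSet l τ b)) η) l u := by
  intro u hu
  -- the set of vertices joined to `l` inside the side (or off the side) is closed under
  -- `η`-adjacency, contains `l`, hence the whole `η`-cluster of `l`, which is everything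
  have key : u ∈ {v | v ∈ sideSet l τ b → Conn ends (restrict (within ends (sideSet l τ b)) η) l v} := by
    refine mem_of_conn_of_closed (ends := ends) (ω := η) ?_ (fun _ => conn_refl _ _ _) (hsp u)
    intro x hx y hxy hy
    obtain ⟨hne, e, he, hends⟩ := openGraph_adj.1 hxy
    by_cases hxS : x ∈ sideSet l τ b
    · -- the edge lies inside the side
      have he' : restrict (within ends (sideSet l τ b)) η e = true :=
        restrict_eq_true_iff.2 ⟨he, x, hxS, y, hy, hends⟩
      exact conn_trans (hx hxS) (conn_of_openAdj ⟨e, he', hends⟩)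
    · -- `x` is off the side: the edge would be a cross edge (closed) unless `y = l`
      by_cases hyl : y = l
      · subst hyl; exact conn_refl _ _ _
      · exfalso
        have hxl : x ≠ l := fun h => hxS (h ▸ root_mem_sideSet τ b)
        have hcross : crossEdge ends l τ e := by
          refine ⟨x, y, hends, hxl, hyl, ?_⟩
          intro hτ
          apply hxS
          rw [mem_sideSet_iff_of_ne hxl, hτ]
          exact (mem_sideSet_iff_of_ne hyl).1 hy
        have := hcl e hcross
        rw [he] at this
        exact Bool.true_eq_false.mp this
  exact key hu

/-- Every vertex lies on one of the two sides. -/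
lemma mem_sideSet_true_or_false (τ : V → Bool) (v : V) :
    v ∈ sideSet l τ true ∨ v ∈ sideSet l τ false := by
  cases h : τ v
  · exact Or.inr (Or.inl h)
  · exact Or.inl (Or.inl h)

/-- **The two internal-connection events with the cross edges closed are exactly
`{η spans} ∩ {cross edges closed}`** (`τ l = false`). -/
theorem internallyConnected_inter_eq {τ : V → Bool} (hl : τ l = false) :
    internallyConnected ends l (sideSet l τ true) ∩ internallyConnected ends l (sideSet l τ false) ∩
        crossClosed ends l τ =
      spanning ends l ∩ crossClosed ends l τ := by
  ext η
  simp only [Set.mem_inter_iff, internallyConnected, Set.mem_setOf_eq]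
  constructor
  · rintro ⟨⟨⟨_, h1⟩, ⟨_, h2⟩⟩, hcl⟩
    refine ⟨fun v => ?_, hcl⟩
    rcases mem_sideSet_true_or_false τ v with hv | hv
    · exact conn_mono (restrict_le _ η) (h1 v hv)
    · exact conn_mono (restrict_le _ η) (h2 v hv)
  · rintro ⟨hsp, hcl⟩
    exact ⟨⟨⟨root_mem_sideSet τ true, conn_restrict_side_of_spanning hl hsp hcl true⟩,
      ⟨root_mem_sideSet τ false, conn_restrict_side_of_spanning hl hsp hcl false⟩⟩, hcl⟩

end Closure

end Part

end Summit.Ventures.PercRepro2
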